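import Mathlib
import HarnessLib
import Literature.Analysis.FluidPDE.TypeIAncientMild
import Literature.Analysis.FluidPDE.LocalTypeIReverseTools
import Literature.Analysis.FluidPDE.LocalTypeIPersistenceHolds
import Literature.Analysis.FluidPDE.LocalTypeIProofs
import Literature.Analysis.FluidPDE.LocalTypeIScaling
import Literature.Analysis.FluidPDE.Seregin2020AncientLimitSymmetry
import Literature.Analysis.FluidPDE.SereginSverakBlowupSelection
import Summits.NavierStokesRegularity.NavierStokesRegularity.Theorems.SqueezeCycleExtremalElementExistsRescale

/-!
# `AxisymEndLiouvilleOfFarPastLedger` (stmt-NavierStokesRegularity-14736), 𝒦-route driver: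
# the blow-down of a nonzero axisymmetric element of `A_C` at an axis point

Route SymmetryModuliCount, item text: "every blow-down `v_k(t,x) = k·v(k²t, c + kx)`, `k → ∞` lies in
`A_C` with the same ledger constant, hence in Albritton–Barker's class 𝒦 uniformly … Compactness in
𝒦 … gives a subsequential limit `v̄`: an axisymmetric suitable weak solution on `Q₁` with uniform
`L³ × L^{3/2}` bounds and `√(−t)|v̄| ≤ C`. Since `v ≠ 0` at some `(t₀,x₀)`,
`‖v_k‖_{L∞(Q_R)} ≥ k|v(t₀,x₀)| → ∞` for every `R`, so `PersistenceOfSingularities_holds` makes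
`(0,0)` a backward singular point of `v̄`."

This file carries out exactly that extraction (`exists_singular_axisymmetric_limit`), for a field
`v` of the Type-I ancient mild class `A_C` (`IsTypeIAncientMild C v`) which is axisymmetric about
the `x₃`-axis on all of `t < 0`, obeys the far-past ledger with constant `K`, and does not vanish at
some `(t₀, x₀)`, `t₀ < 0`. The two analytic inputs are kept as HYPOTHESES of the theorem, to be
discharged by the sibling helper files of the item:

* `hcubic` — the uniform cubic bound `∫_{Q(0,1)} ‖w‖³ ≤ 2CK` for every `w ∈ A_C` with ledger `K`
  (proved: `Theorems/SymmetryModuliCountAxisymEndLiouvilleOfFarPastLedgerCubic.lean`,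
  `lintegral_parabolicCylinder_le`);
* `hPress` — the PRESSURE PACKAGE: every backward shift `w(· − T)`, `0 < T ≤ 1`, of a `w ∈ A_C`
  with ledger `K` admits a pressure `q` making it a suitable weak solution in the unit parabolic
  ball `Q(0,1)` in Albritton–Barker's class (Def. 2.1) with `∫_{Q(0,1)} |q|^{3/2} ≤ D₀` (the
  Oseen pressure, near/far Calderón–Zygmund split; the `D`-half of "`A_C ⊂ 𝒦`").

Mechanism: centre `z₁ = (t₁, x₁)` with `t₁ = t₀/2` and `x₁` the axis point at the height of `x₀`;
scales `c_k = k + 1 + √(−t₁) → ∞`; the blow-downs `V_k = c_k v(t₁ + c_k² ·, x₁ + c_k ·)` are the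
shifts by `T_k = −t₁/c_k² ∈ (0,1]` of the zooms `w_k = c_k v(c_k² ·, x₁ + c_k ·) ∈ A_C`
(`isTypeIAncientMild_zoom`; ledger by `scaledEnergy_zoom`), exactly axisymmetric, with
`‖V_k‖_{L∞(Q(0,R))} → ∞` (`eLpNorm_top_nsZoom`); `SuitableCompactness_holds` and
`PersistenceOfSingularities_holds` give the limit, a.e. axisymmetric by
`Seregin2020.ae_rot_eq_of_tendsto_eLpNorm` and a.e. Type-I through an a.e.-convergent subsequence.

## References

* D. Albritton, T. Barker, J. Math. Fluid Mech. 21 (2019) = arXiv:1811.00502, Lemma 2.2,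
  Prop. 2.3, §3. [AlbrittonBarker2019]
* G. Seregin, V. Šverák, Comm. PDE 34 (2009), Thm 3.1. [SereginSverak2009]
-/

noncomputable section

-- the summit and its single problem share the name (D-0017 nested layout)
set_option linter.dupNamespace false

open MeasureTheory Set Metric Filter Function TopologicalSpace
open scoped ENNReal NNReal Topology

namespace Summit.NavierStokesRegularity.NavierStokesRegularity.Theorems.AxisymEndLiouvilleOfFarPastLedger

open Literature.Analysis.FluidPDE
open Summit.NavierStokesRegularity.NavierStokesRegularity.Theorems

/-! ### Small tools -/

/-- **Pointwise bounds pass to strong `L³` limits (a.e. form).** If `F_j → f` in `L³(μ)` and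
`‖F_j‖ ≤ g` a.e. for every `j`, then `‖f‖ ≤ g` a.e. (an a.e.-convergent subsequence). [folklore] -/
theorem ae_norm_le_of_tendsto_eLpNorm {X : Type*} [MeasurableSpace X] {μ : Measure X}
    {G : Type*} [NormedAddCommGroup G] {F : ℕ → X → G} {f : X → G} {g : X → ℝ}
    (hF : ∀ j, AEStronglyMeasurable (F j) μ) (hf : AEStronglyMeasurable f μ)
    (hconv : Tendsto (fun j => eLpNorm (F j - f) 3 μ) atTop (𝓝 0))
    (hb : ∀ j, ∀ᵐ z ∂μ, ‖F j z‖ ≤ g z) : ∀ᵐ z ∂μ, ‖f z‖ ≤ g z := by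
  have h1 : TendstoInMeasure μ F atTop f :=
    tendstoInMeasure_of_tendsto_eLpNorm (by norm_num) hF hf hconv
  obtain ⟨ns, -, hae⟩ := h1.exists_seq_tendsto_ae
  have hb' : ∀ᵐ z ∂μ, ∀ j, ‖F j z‖ ≤ g z := ae_all_iff.2 hb
  filter_upwards [hae, hb'] with z hz hbz
  exact le_of_tendsto' hz.norm fun i => hbz (ns i)

/-- A continuous field which does not vanish at a point of an open set is not essentially zero
there: `‖u‖_{L∞(Q(z₁, ρ))} ≠ 0`. [folklore] -/
theorem eLpNorm_top_ne_zero_of_continuousOn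
    {v : ℝ → EuclideanSpace ℝ (Fin 3) → EuclideanSpace ℝ (Fin 3)}
    {O : Set (ℝ × EuclideanSpace ℝ (Fin 3))} (hv : ContinuousOn (uncurry v) O)
    {z₁ : ℝ × EuclideanSpace ℝ (Fin 3)} {ρ : ℝ} (hQO : parabolicCylinder ρ z₁ ⊆ O)
    {z₀ : ℝ × EuclideanSpace ℝ (Fin 3)} (hz₀ : z₀ ∈ parabolicCylinder ρ z₁) (hne : uncurry v z₀ ≠ 0) :
    eLpNorm (uncurry v) ∞ (volume.restrict (parabolicCylinder ρ z₁)) ≠ 0 := by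
  intro h0
  have hQm : MeasurableSet (parabolicCylinder ρ z₁) := (isOpen_parabolicCylinder ρ z₁).measurableSet
  have hmeas : AEStronglyMeasurable (uncurry v) (volume.restrict (parabolicCylinder ρ z₁)) :=
    (hv.mono hQO).aestronglyMeasurable hQm
  have hae : uncurry v =ᵐ[volume.restrict (parabolicCylinder ρ z₁)] 0 :=
    (eLpNorm_eq_zero_iff hmeas ENNReal.top_ne_zero).1 h0
  -- the open set where `v ≠ 0` inside the cylinder has positive measure
  set W : Set (ℝ × EuclideanSpace ℝ (Fin 3)) := parabolicCylinder ρ z₁ ∩ (uncurry v) ⁻¹' {0}ᶜ with hW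
  have hWo : IsOpen W :=
    (hv.mono hQO).isOpen_inter_preimage (isOpen_parabolicCylinder ρ z₁)
      (isOpen_compl_singleton (x := (0 : EuclideanSpace ℝ (Fin 3))))
  have hWne : W.Nonempty := ⟨z₀, hz₀, hne⟩
  have hWpos : 0 < volume W := hWo.measure_pos volume hWne
  have hWzero : volume W = 0 := by
    have h1 : ∀ᵐ z ∂(volume.restrict (parabolicCylinder ρ z₁)), z ∉ W := by
      filter_upwards [hae] with z hz
      intro hzW
      exact hzW.2 hz
    rw [ae_restrict_iff' hQm] at h1
    have hW0 : ∀ᵐ z ∂(volume : Measure (ℝ × EuclideanSpace ℝ (Fin 3))), z ∉ W := by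
      filter_upwards [h1] with z hz
      intro hzW
      exact hz hzW.1 hzW
    have h2 := ae_iff.1 hW0
    simpa only [not_not, setOf_mem_eq] using h2
  exact hWpos.ne' hWzero

/-- **Blow-up of the `L^∞` norms along a blow-down sequence** (general radius): if
`‖u‖_{L∞(Q(z₁, ρ))} ≠ 0` and `c_k → ∞`, `c_k > 0`, then for every `R > 0` the zoomed fields
`c_k u(t₁ + c_k² s, x₁ + c_k y)` have `‖·‖_{L∞(Q(0, R))} → ∞` (for `c_k R ≥ ρ`,
`‖·‖_{L∞(Q(0,R))} = c_k ‖u‖_{L∞(Q(z₁, c_k R))} ≥ c_k ‖u‖_{L∞(Q(z₁, ρ))}`; Albritton–Barker 2019, §3,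
with the unit radius replaced by `ρ`). [cite: AlbrittonBarker2019, §3] -/
theorem tendsto_eLpNorm_top_zoom_atTop
    {u : ℝ → EuclideanSpace ℝ (Fin 3) → EuclideanSpace ℝ (Fin 3)}
    {z₁ : ℝ × EuclideanSpace ℝ (Fin 3)} {c : ℕ → ℝ} {ρ : ℝ} (hρ : 0 < ρ)
    (hc : ∀ k, 0 < c k) (hctop : Tendsto c atTop atTop)
    (hN : eLpNorm (uncurry u) ∞ (volume.restrict (parabolicCylinder ρ z₁)) ≠ 0) {R : ℝ}
    (hR : 0 < R) :
    Tendsto (fun k => eLpNorm (uncurry ((c k) • stPull (c k ^ 2) (c k) z₁.1 z₁.2 u)) ∞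
      (volume.restrict (parabolicCylinder R 0))) atTop (𝓝 ∞) := by
  set N := eLpNorm (uncurry u) ∞ (volume.restrict (parabolicCylinder ρ z₁)) with hNdef
  have hb : Tendsto (fun k => ENNReal.ofReal (c k) * N) atTop (𝓝 ∞) := by
    have h1 : Tendsto (fun k => ENNReal.ofReal (c k)) atTop (𝓝 ∞) :=
      ENNReal.tendsto_ofReal_atTop.comp hctop
    have h2 := ENNReal.Tendsto.mul_const h1 (Or.inl ENNReal.top_ne_zero) (b := N)
    rwa [ENNReal.top_mul hN] at h2
  refine tendsto_nhds_top_mono hb ?_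
  filter_upwards [hctop.eventually_ge_atTop (ρ * R⁻¹)] with k hk
  have hcR : ρ ≤ c k * R := by
    have := mul_le_mul_of_nonneg_right hk hR.le
    rwa [mul_assoc, inv_mul_cancel₀ hR.ne', mul_one] at this
  have h0 : stAffine (c k ^ 2) (c k) z₁.1 z₁.2 0 = z₁ := by
    ext <;> simp [stAffine]
  rw [eLpNorm_top_nsZoom (hc k) z₁.1 z₁.2 R 0, h0]
  gcongr
  refine eLpNorm_mono_measure _ (Measure.restrict_mono ?_ le_rfl)
  have h2 : ρ ^ 2 ≤ (c k * R) ^ 2 := pow_le_pow_left₀ hρ.le hcR 2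
  exact prod_mono (Ioo_subset_Ioo (by linarith) le_rfl) (ball_subset_ball hcR)

/-- `(∫ ‖f‖ₑ³)^{1/3}` is the `L³` norm, `(∫ ‖q‖ₑ^{3/2})^{2/3}` the `L^{3/2}` norm: the two uniform
bounds of the blow-down sequence in the form `SuitableCompactness` consumes them. [folklore] -/
theorem eLpNorm_three_add_le {X : Type*} [MeasurableSpace X] {μ : Measure X}
    {f : X → EuclideanSpace ℝ (Fin 3)} {q : X → ℝ} {a b : ℝ≥0∞}
    (hf : ∫⁻ z, ‖f z‖ₑ ^ (3 : ℕ) ∂μ ≤ a) (hq : ∫⁻ z, ‖q z‖ₑ ^ (3 / 2 : ℝ) ∂μ ≤ b) :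
    eLpNorm f 3 μ + eLpNorm q (3 / 2) μ ≤ a ^ (1 / 3 : ℝ) + b ^ (2 / 3 : ℝ) := by
  obtain ⟨h32, h32', h32r⟩ := threeHalves_facts
  refine add_le_add ?_ ?_
  · rw [eLpNorm_eq_lintegral_rpow_enorm_toReal (by norm_num) (by norm_num)]
    have e3 : (3 : ℝ≥0∞).toReal = ((3 : ℕ) : ℝ) := by norm_num
    rw [e3]
    simp only [ENNReal.rpow_natCast]
    have e13 : (1 / ((3 : ℕ) : ℝ)) = (1 / 3 : ℝ) := by norm_num
    rw [e13]
    exact ENNReal.rpow_le_rpow hf (by norm_num)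
  · rw [eLpNorm_eq_lintegral_rpow_enorm_toReal (zero_lt_one.trans_le h32).ne' h32', h32r]
    have e23 : (1 / (3 / 2 : ℝ)) = (2 / 3 : ℝ) := by norm_num
    rw [e23]
    exact ENNReal.rpow_le_rpow hq (by norm_num)

/-! ### The extraction -/

/-- **𝒦-route driver: the blow-down of a nonzero axisymmetric element of `A_C` with the ledger
has a singular, a.e.-axisymmetric, a.e.-Type-I limit in Albritton–Barker's class.** Inputs:
`v ∈ A_C` axisymmetric about the `x₃`-axis on `t < 0`, with ledger constant `K`, and
`v(t₀, x₀) ≠ 0` for some `t₀ < 0`; the uniform cubic bound `hcubic` and the pressure package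
`hPress` for the class (module docstring). Output: a suitable weak solution `(u, p)` in the
parabolic ball `Q(0, 1/2)` (A–B Def. 2.1) with `u ∈ L³`, a.e. axisymmetric for every angle,
`√(−s)‖u‖ ≤ C` a.e., whose vertex is a backward singular point — the subsequential limit
(`SuitableCompactness_holds`) of the blow-downs `c_k v(t₁ + c_k² s, x₁ + c_k y)` at the axis point
`x₁` below `x₀`, singular by `PersistenceOfSingularities_holds`.
[cite: AlbrittonBarker2019, Lemma 2.2, Prop. 2.3 and §3] -/
theorem exists_singular_axisymmetric_limit {C K D₀ : ℝ}
    (hcubic : ∀ w : ℝ → EuclideanSpace ℝ (Fin 3) → EuclideanSpace ℝ (Fin 3), IsTypeIAncientMild C w →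
      (∀ t < 0, ∀ (x₀ : EuclideanSpace ℝ (Fin 3)) (R : ℝ), 0 < R →
        ∫ x in ball x₀ R, ‖w t x‖ ^ 2 ≤ K * R) →
      ∫⁻ z in parabolicCylinder 1 (0 : ℝ × EuclideanSpace ℝ (Fin 3)), ‖w z.1 z.2‖ₑ ^ (3 : ℕ) ≤
        ENNReal.ofReal (2 * C * K))
    (hPress : ∀ w : ℝ → EuclideanSpace ℝ (Fin 3) → EuclideanSpace ℝ (Fin 3), IsTypeIAncientMild C w →
      (∀ t < 0, ∀ (x₀ : EuclideanSpace ℝ (Fin 3)) (R : ℝ), 0 < R →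
        ∫ x in ball x₀ R, ‖w t x‖ ^ 2 ≤ K * R) →
      ∀ T ∈ Ioc (0 : ℝ) 1, ∃ q : ℝ → EuclideanSpace ℝ (Fin 3) → ℝ,
        IsSuitableWeakSolutionInBall 1 0 (fun s y => w (s - T) y) q ∧
        ∫⁻ z in parabolicCylinder 1 (0 : ℝ × EuclideanSpace ℝ (Fin 3)), ‖q z.1 z.2‖ₑ ^ (3 / 2 : ℝ) ≤
          ENNReal.ofReal D₀)
    {v : ℝ → EuclideanSpace ℝ (Fin 3) → EuclideanSpace ℝ (Fin 3)} (hv : IsTypeIAncientMild C v)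
    (hKv : ∀ t < 0, ∀ (x₀ : EuclideanSpace ℝ (Fin 3)) (R : ℝ), 0 < R →
      ∫ x in ball x₀ R, ‖v t x‖ ^ 2 ≤ K * R)
    (hax : ∀ t < 0, IsAxisymmetric (v t))
    {t₀ : ℝ} (ht₀ : t₀ < 0) {x₀ : EuclideanSpace ℝ (Fin 3)} (hne : v t₀ x₀ ≠ 0) :
    ∃ (u : ℝ → EuclideanSpace ℝ (Fin 3) → EuclideanSpace ℝ (Fin 3)) (p : ℝ → EuclideanSpace ℝ (Fin 3) → ℝ),
      IsSuitableWeakSolutionInBall (1 / 2) 0 u p ∧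
      MemLp (uncurry u) 3 (volume.restrict (parabolicCylinder (1 / 2) (0 : ℝ × EuclideanSpace ℝ (Fin 3)))) ∧
      (∀ θ : ℝ, ∀ᵐ z ∂(volume.restrict (parabolicCylinder (1 / 2) (0 : ℝ × EuclideanSpace ℝ (Fin 3)))),
        rotZ θ (u z.1 (rotZ (-θ) z.2)) = u z.1 z.2) ∧
      (∀ᵐ z ∂(volume.restrict (parabolicCylinder (1 / 2) (0 : ℝ × EuclideanSpace ℝ (Fin 3)))),
        Real.sqrt (-z.1) * ‖u z.1 z.2‖ ≤ C) ∧
      IsBackwardSingularPoint u 0 := by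
  -- ### the centre on the axis, the radius, the scales
  set x₁ : EuclideanSpace ℝ (Fin 3) := (x₀ 2) • (eZ : EuclideanSpace ℝ (Fin 3)) with hx₁
  set t₁ : ℝ := t₀ / 2 with ht₁
  have ht₁0 : t₁ < 0 := by rw [ht₁]; linarith
  have ht₀₁ : t₀ < t₁ := by rw [ht₁]; linarith
  set z₁ : ℝ × EuclideanSpace ℝ (Fin 3) := (t₁, x₁) with hz₁
  set ρ : ℝ := ‖x₀ - x₁‖ + Real.sqrt (t₁ - t₀) + 1 with hρ
  have hρ0 : 0 < ρ := by positivity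
  have hz₀ : ((t₀, x₀) : ℝ × EuclideanSpace ℝ (Fin 3)) ∈ parabolicCylinder ρ z₁ := by
    rw [mem_parabolicCylinder]
    refine ⟨⟨?_, ht₀₁⟩, ?_⟩
    · show t₁ - ρ ^ 2 < t₀
      have h1 : Real.sqrt (t₁ - t₀) ^ 2 = t₁ - t₀ := Real.sq_sqrt (by linarith)
      have h2 : Real.sqrt (t₁ - t₀) < ρ := by
        rw [hρ]; linarith [norm_nonneg (x₀ - x₁)]
      have h3 : Real.sqrt (t₁ - t₀) ^ 2 < ρ ^ 2 := pow_lt_pow_left₀ h2 (Real.sqrt_nonneg _) two_ne_zero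
      linarith
    · show dist x₀ x₁ < ρ
      rw [dist_eq_norm, hρ]
      linarith [Real.sqrt_nonneg (t₁ - t₀)]
  -- `‖v‖_{L∞(Q(z₁, ρ))} ≠ 0`
  have hQO : parabolicCylinder ρ z₁ ⊆ Iio (0 : ℝ) ×ˢ (univ : Set (EuclideanSpace ℝ (Fin 3))) :=
    parabolicCylinder_subset_lowerHalf ht₁0.le ρ
  have hN : eLpNorm (uncurry v) ∞ (volume.restrict (parabolicCylinder ρ z₁)) ≠ 0 :=
    eLpNorm_top_ne_zero_of_continuousOn hv.continuousOn_uncurry hQO hz₀ hne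
  set c : ℕ → ℝ := fun k => (k : ℝ) + 1 + Real.sqrt (-t₁) with hc
  have hcpos : ∀ k, 0 < c k := fun k => by simp only [hc]; positivity
  have hctop : Tendsto c atTop atTop := by
    simp only [hc]
    refine tendsto_atTop_add_const_right _ _ ?_
    exact tendsto_atTop_add_const_right _ _ tendsto_natCast_atTop_atTop
  have hcsq : ∀ k, -t₁ ≤ c k ^ 2 := fun k => by
    have h1 : Real.sqrt (-t₁) ≤ c k := by
      simp only [hc]; linarith [Nat.cast_nonneg (α := ℝ) k]
    calc -t₁ = Real.sqrt (-t₁) ^ 2 := (Real.sq_sqrt (by linarith)).symm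
      _ ≤ c k ^ 2 := pow_le_pow_left₀ (Real.sqrt_nonneg _) h1 2
  set T : ℕ → ℝ := fun k => -t₁ / c k ^ 2 with hT
  have hT0 : ∀ k, 0 < T k := fun k => div_pos (by linarith) (pow_pos (hcpos k) 2)
  have hT1 : ∀ k, T k ≤ 1 := fun k => (div_le_one (pow_pos (hcpos k) 2)).2 (hcsq k)
  -- ### the zooms `w_k ∈ A_C` and their ledger
  set w : ℕ → ℝ → EuclideanSpace ℝ (Fin 3) → EuclideanSpace ℝ (Fin 3) :=
    fun k => (c k) • stPull (c k ^ 2) (c k) 0 x₁ v with hw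
  have hwA : ∀ k, IsTypeIAncientMild C (w k) := fun k => isTypeIAncientMild_zoom hv (hcpos k) x₁
  have hKw : ∀ k, ∀ t < 0, ∀ (y₀ : EuclideanSpace ℝ (Fin 3)) (R : ℝ), 0 < R →
      ∫ y in ball y₀ R, ‖w k t y‖ ^ 2 ≤ K * R := by
    intro k t ht y₀ R hR
    have h1 := scaledEnergy_zoom (hcpos k) x₁ y₀ v t hR
    have hct : c k ^ 2 * t < 0 := mul_neg_of_pos_of_neg (pow_pos (hcpos k) 2) ht
    have hcR : 0 < c k * R := mul_pos (hcpos k) hR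
    have h2 : ∫ x in ball (x₁ + c k • y₀) (c k * R), ‖v (c k ^ 2 * t) x‖ ^ 2 ≤ K * (c k * R) :=
      hKv _ hct _ _ hcR
    have h3 : R⁻¹ * ∫ y in ball y₀ R, ‖w k t y‖ ^ 2 ≤ K := by
      rw [hw, h1]
      calc (c k * R)⁻¹ * ∫ x in ball (x₁ + c k • y₀) (c k * R), ‖v (c k ^ 2 * t) x‖ ^ 2
          ≤ (c k * R)⁻¹ * (K * (c k * R)) := mul_le_mul_of_nonneg_left h2 (inv_nonneg.2 hcR.le)
        _ = K := by rw [mul_comm K, ← mul_assoc, inv_mul_cancel₀ hcR.ne', one_mul]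
    have h4 : ∫ y in ball y₀ R, ‖w k t y‖ ^ 2 ≤ R * K := (inv_mul_le_iff₀ hR).1 h3
    linarith [mul_comm R K]
  -- ### the blow-downs `V_k = w_k(· - T_k) = c_k v(t₁ + c_k² ·, x₁ + c_k ·)`
  set V : ℕ → ℝ → EuclideanSpace ℝ (Fin 3) → EuclideanSpace ℝ (Fin 3) :=
    fun k => (c k) • stPull (c k ^ 2) (c k) t₁ x₁ v with hV
  have hcT : ∀ k (s : ℝ), c k ^ 2 * (s - T k) = t₁ + c k ^ 2 * s := fun k s => by
    have hc0 : c k ≠ 0 := (hcpos k).ne'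
    simp only [hT]
    field_simp
    ring
  have hVw : ∀ k, (fun s y => w k (s - T k) y) = V k := by
    intro k
    funext s y
    simp only [hw, hV, smul_stPull_apply, zero_add, hcT]
  have hVapply : ∀ k (s : ℝ) (y : EuclideanSpace ℝ (Fin 3)),
      V k s y = c k • v (t₁ + c k ^ 2 * s) (x₁ + c k • y) := fun k s y => by
    simp only [hV, smul_stPull_apply]
  have hVA : ∀ k, IsTypeIAncientMild C (V k) := fun k => by
    rw [← hVw k]; exact (hwA k).comp_sub_right (hT0 k).le
  have hKV : ∀ k, ∀ t < 0, ∀ (y₀ : EuclideanSpace ℝ (Fin 3)) (R : ℝ), 0 < R →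
      ∫ y in ball y₀ R, ‖V k t y‖ ^ 2 ≤ K * R := by
    intro k t ht y₀ R hR
    rw [← hVw k]
    exact hKw k (t - T k) (by linarith [hT0 k]) y₀ R hR
  -- exact axisymmetry of the blow-downs on `s < 0`
  have hVsym : ∀ k (θ : ℝ) (s : ℝ), s < 0 → ∀ y : EuclideanSpace ℝ (Fin 3),
      V k s (rotZ θ y) = rotZ θ (V k s y) := by
    intro k θ s hs y
    have hts : t₁ + c k ^ 2 * s < 0 := by nlinarith [pow_pos (hcpos k) 2]
    rw [hVapply, hVapply, SereginSverak2009.rotZ_smul_vec θ (c k) (v _ _), ← hax _ hts θ (x₁ + c k • y),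
      SereginSverak2009.rotZ_add_vec, hx₁, SereginSverak2009.rotZ_smul_eZ, SereginSverak2009.rotZ_smul_vec]
  -- ### the pressures
  have hq : ∀ k, ∃ q : ℝ → EuclideanSpace ℝ (Fin 3) → ℝ, IsSuitableWeakSolutionInBall 1 0 (V k) q ∧
      ∫⁻ z in parabolicCylinder 1 (0 : ℝ × EuclideanSpace ℝ (Fin 3)), ‖q z.1 z.2‖ₑ ^ (3 / 2 : ℝ) ≤
        ENNReal.ofReal D₀ := by
    intro k
    obtain ⟨q, h1, h2⟩ := hPress (w k) (hwA k) (hKw k) (T k) ⟨hT0 k, hT1 k⟩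
    rw [hVw k] at h1
    exact ⟨q, h1, h2⟩
  choose q hball hqD using hq
  -- ### the hypotheses of Lemma 2.2
  have hsup : (⨆ k, eLpNorm (uncurry (V k)) 3
        (volume.restrict (parabolicCylinder 1 (0 : ℝ × EuclideanSpace ℝ (Fin 3)))) +
      eLpNorm (uncurry (q k)) (3 / 2)
        (volume.restrict (parabolicCylinder 1 (0 : ℝ × EuclideanSpace ℝ (Fin 3))))) < ∞ := by
    have hbound : ∀ k, eLpNorm (uncurry (V k)) 3
          (volume.restrict (parabolicCylinder 1 (0 : ℝ × EuclideanSpace ℝ (Fin 3)))) +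
        eLpNorm (uncurry (q k)) (3 / 2)
          (volume.restrict (parabolicCylinder 1 (0 : ℝ × EuclideanSpace ℝ (Fin 3)))) ≤
        ENNReal.ofReal (2 * C * K) ^ (1 / 3 : ℝ) + ENNReal.ofReal D₀ ^ (2 / 3 : ℝ) := fun k =>
      eLpNorm_three_add_le (hcubic (V k) (hVA k) (hKV k)) (hqD k)
    refine lt_of_le_of_lt (iSup_le hbound) ?_
    exact ENNReal.add_lt_top.2 ⟨ENNReal.rpow_lt_top_of_nonneg (by norm_num) ENNReal.ofReal_ne_top,
      ENNReal.rpow_lt_top_of_nonneg (by norm_num) ENNReal.ofReal_ne_top⟩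
  -- ### Lemma 2.2 and persistence of singularities
  obtain ⟨u, p, σ, hσ, hlim⟩ := SuitableCompactness_holds V q hball hsup
  have hsing : IsBackwardSingularPoint u 0 := by
    refine PersistenceOfSingularities_holds (fun j => V (σ j)) (fun j => q (σ j)) u p
      (fun j => hball (σ j)) ?_ ?_ ?_
    · refine lt_of_le_of_lt (iSup_le fun j => ?_) hsup
      exact le_iSup (fun k => eLpNorm (uncurry (V k)) 3
        (volume.restrict (parabolicCylinder 1 (0 : ℝ × EuclideanSpace ℝ (Fin 3)))) +
        eLpNorm (uncurry (q k)) (3 / 2)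
        (volume.restrict (parabolicCylinder 1 (0 : ℝ × EuclideanSpace ℝ (Fin 3))))) (σ j)
    · intro R hR
      obtain ⟨h1, -, h3, h4⟩ := hlim R hR
      exact ⟨h1, h3, h4⟩
    · intro R hR
      have ht := tendsto_eLpNorm_top_zoom_atTop (u := v) (z₁ := z₁) hρ0 (fun j => hcpos (σ j))
        (hctop.comp hσ.tendsto_atTop) hN hR.1
      exact ht.limsup_eq
  -- ### the limit on `Q(0, 1/2)`
  have h12 : (1 / 2 : ℝ) ∈ Ioo (0 : ℝ) 1 := ⟨by norm_num, by norm_num⟩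
  obtain ⟨hballu, hL3u, hconv, -⟩ := hlim (1 / 2) h12
  set Q₂ : Set (ℝ × EuclideanSpace ℝ (Fin 3)) := parabolicCylinder (1 / 2) (0 : ℝ × EuclideanSpace ℝ (Fin 3))
    with hQ₂
  have hQ₂sub : Q₂ ⊆ Ioo (-1 : ℝ) 0 ×ˢ (univ : Set (EuclideanSpace ℝ (Fin 3))) := by
    intro z hz
    rw [hQ₂, mem_parabolicCylinder] at hz
    refine ⟨⟨?_, ?_⟩, mem_univ _⟩
    · have := hz.1.1; simp at this; linarith
    · have := hz.1.2; simpa using this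
  have hVm : ∀ j, AEStronglyMeasurable (uncurry (V (σ j))) (volume.restrict Q₂) := fun j =>
    ((hVA (σ j)).aestronglyMeasurable_uncurry (s := -1) le_rfl).mono_measure
      (Measure.restrict_mono hQ₂sub le_rfl)
  have hum : AEStronglyMeasurable (uncurry u) (volume.restrict Q₂) := hL3u.1
  -- a.e. axisymmetry of the limit
  have hsymu : ∀ θ : ℝ, ∀ᵐ z ∂(volume.restrict Q₂), rotZ θ (u z.1 (rotZ (-θ) z.2)) = u z.1 z.2 := by
    intro θ
    have h := Seregin2020.ae_rot_eq_of_tendsto_eLpNorm (-θ) hVm hum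
      (fun j z hz => hVsym (σ j) (-θ) z.1 (by
        have := (mem_parabolicCylinder.1 hz).1.2; simpa using this) z.2) hconv
    filter_upwards [h] with z hz
    rw [hz, ← rotZ_add, add_neg_cancel, rotZ_zero]
  -- a.e. Type-I bound of the limit
  have htypeIu : ∀ᵐ z ∂(volume.restrict Q₂), Real.sqrt (-z.1) * ‖u z.1 z.2‖ ≤ C := by
    have hQm : MeasurableSet Q₂ := (isOpen_parabolicCylinder _ _).measurableSet
    have hb : ∀ j, ∀ᵐ z ∂(volume.restrict Q₂), ‖uncurry (V (σ j)) z‖ ≤ C / Real.sqrt (-z.1) := by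
      intro j
      filter_upwards [ae_restrict_mem hQm] with z hz
      have hs : z.1 < 0 := by have := (mem_parabolicCylinder.1 hz).1.2; simpa using this
      exact (hVA (σ j)).norm_le hs z.2
    have h := ae_norm_le_of_tendsto_eLpNorm hVm hum hconv hb
    filter_upwards [h, ae_restrict_mem hQm] with z hz hzQ
    have hs : z.1 < 0 := by have := (mem_parabolicCylinder.1 hzQ).1.2; simpa using this
    have hsq : 0 < Real.sqrt (-z.1) := Real.sqrt_pos.2 (by linarith)
    have := mul_le_mul_of_nonneg_left hz hsq.le
    rwa [mul_div_cancel₀ _ hsq.ne'] at this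
  exact ⟨u, p, hballu, hL3u, hsymu, htypeIu, hsing⟩

end Summit.NavierStokesRegularity.NavierStokesRegularity.Theorems.AxisymEndLiouvilleOfFarPastLedger

end
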